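import Summits.BirchSwinnertonDyer.BirchSwinnertonDyer.Theorems.EisensteinPrimesKatzLineIntFrameOfTeichmuller
import Summits.BirchSwinnertonDyer.BirchSwinnertonDyer.Theorems.EisensteinPrimesGoodLatticeBDPValueOfLambdaIdentityAnQ
import Literature.NumberTheory.EllipticCurves.CastellaGrossiLeeSkinner2022.KatzPAdicLFunctionExistence
import HarnessLib

/-!
# Crux 2 `GoodLatticeBDPValue` (stmt-BirchSwinnertonDyer-19032), line `halves` v19: the registered stub
# `stub_katzLineIntFrameQ` (AN-F₁ in the ℚ-currency) CLOSED by the width seat's landed theorem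

Cell `bsd-eis`, seat `bsd-line-x1-p1` LEAD g3 (D-0154 KEY row 4). The closer of record is seat
`bsd-line-x1-p1-w2` gen 2's `KatzLineFrame.katzLineIntFrame_of_teichmullerPair`
(`Theorems/EisensteinPrimesKatzLineIntFrameOfTeichmuller.lean`, with its chain `…KatzLineFactor` p632xxx,
`…KatzLineFirstUnitIndex`, `…KatzLineIntFrame`): on the data of the good lattice read over `ℚ` (rational
`p`-line `Φ`, Teichmüller pair `(θsub, θquot)`, `θ_K` the Hecke character of `θquot|_{Γ_K}`, its exact
ramification set `S`, a generator pair, de Shalit data and a two-variable frame `G` of `θ_K⁻¹` with a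
`ℤ_p`-form `g`, `g(S=0) mod p ≠ 0`), GRANTED de Shalit II.6.4 (PUB), there is an `𝓞_{ℂ_p}`-valued CGLS-type
frame `(Ω_K', Ω_p', Q)` of `θ_K` on the anticyclotomic line (`Cbar = ∅`, `‖Ω_p'‖ = 1`) with first unit
coefficient at `ord(g(S=0) mod p)`. This file only restates it under the registered name and header (the
LEAD's skeleton v19 types the stub as `thmII64 → ∀ W p, …` with that theorem's body VERBATIM). HONEST
FRAMING: no definition, no named fact, no sorry; nothing about BSD / IMC2 is proved; the crux stays open on
`stub_imprimLambda` (PRE), `stub_anThreeTrivial` (PRE), `stub_katzLineDescentQ` (kernel) and the PUB bundles.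
References: [deShalit1987] II.4.16–4.17, II.6.4 (i); [CastellaGrossiLeeSkinner2022] Thm. 2.1.2; [KellerYin2024]
Thms. 2.2.1–2.2.2; [Kriz2016] Thm. 27.
-/

set_option linter.dupNamespace false
set_option autoImplicit false

noncomputable section

open scoped Classical

open PowerSeries WeierstrassCurve NumberField IsDedekindDomain Field
  Literature.NumberTheory.GaloisRepresentations Literature.NumberTheory.EllipticCurves.GreenbergVatsal2000
  Summit.BirchSwinnertonDyer.BirchSwinnertonDyer.Theorems.EisensteinPrimesMuLambda
  Literature.NumberTheory.EllipticCurves Literature.NumberTheory.EllipticCurves.ModularForms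
  Literature.NumberTheory.EllipticCurves.Rank1Residual Literature.NumberTheory.EllipticCurves.Castella2018
  Literature.NumberTheory.EllipticCurves.GreenbergSelmer Literature.NumberTheory.QuadraticFields
  Literature.NumberTheory.EllipticCurves.CastellaGrossiLeeSkinner2022
  Literature.NumberTheory.EllipticCurves.KellerYin2024 Literature.NumberTheory.EllipticCurves.IwasawaAlgebra
  Literature.NumberTheory.EllipticCurves.Rubin1991 Literature.NumberTheory.EllipticCurves.DeShalit1987
  Literature.NumberTheory.EllipticCurves.Hida2010MuInvariant Literature.NumberTheory.EllipticCurves.BCGKPST2020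
open Literature.NumberTheory.IwasawaTheory Literature.NumberTheory.IwasawaTheory.Greenberg2016
  Literature.NumberTheory.IwasawaTheory.Greenberg2006
open Summit.BirchSwinnertonDyer.Rank1Residual.X1.KellerYinHalves
  Summit.BirchSwinnertonDyer.Rank1Residual.X1.KellerYinMuLambdaSplitDSFree
  Summit.BirchSwinnertonDyer.BirchSwinnertonDyer.Theorems
  Summit.BirchSwinnertonDyer.BirchSwinnertonDyer.Theorems.GoodLatticeBDPValueHalves
  Summit.BirchSwinnertonDyer.BirchSwinnertonDyer.Theorems.GoodLatticeBDPValueOfImprimitive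
  Summit.BirchSwinnertonDyer.BirchSwinnertonDyer.Theorems.GoodLatticeBDPValueOfOneInequality

namespace Summit.BirchSwinnertonDyer.BirchSwinnertonDyer.Theorems.GoodLatticeBDPValueAnQStubs

/-- **Registered stub `stub_katzLineIntFrameQ` of skeleton `halves` v19 (AN-F₁ in the ℚ-currency), CLOSED**:
`thmII64 →` the statement of `KatzLineFrame.katzLineIntFrame_of_teichmullerPair` (seat bsd-line-x1-p1-w2 gen 2),
by that theorem. [cite: deShalit1987, II.6.4 Theorem (i) (9), (14)–(15); II.4.16 (49)–(50)]
[cite: CastellaGrossiLeeSkinner2022, Thm. 2.1.2 (arXiv:2008.02571v2 TeX L1015–1041)] [cite: KellerYin2024, Thms. 2.2.1–2.2.2 (arXiv:2402.12781v2 TeX L1426–1448)] -/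
theorem stub_katzLineIntFrameQ :
    thmII64_katzMeasure₂_functionalEquation →
    ∀ (W : WeierstrassCurve ℚ) [W.IsElliptic] [W.IsGloballyMinimal] (p : ℕ) [Fact p.Prime],
      2 < p → Good W p → Red W p → Anom W p →
      (∀ Φ : AddSubgroup (geomTorsion W (p : ℤ)), IsRationalLine W p Φ → ¬ LineUnramifiedAt W p Φ) →
      ∀ (K : Type) [Field K] [NumberField K], IsImaginaryQuadratic K →
        SatisfiesHeegnerHypothesis (W.conductorNorm ℤ) K → SatisfiesHeegnerHypothesis p K →
        Odd (NumberField.discr K) → NumberField.discr K ≠ -3 →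
      ∀ (ι : K →+* ℚ_[p]) (v vbar : HeightOneSpectrum (𝓞 K)),
        (∀ x : 𝓞 K, x ∈ v.asIdeal ↔ ‖ι (x : K)‖ < 1) →
        ((p : ℕ) : 𝓞 K) ∈ vbar.asIdeal → vbar ≠ v →
      ∀ (κ : ZpExtension K p), κ.IsAnticyclotomic →
      ∀ (γ : absoluteGaloisGroup K) [Fact (κ.IsTopGenerator γ)],
      ∀ (ι' : PadicAlgCl p ≃+* ℂ),
        (∀ (w : InfinitePlace K) (k : 𝓞 K), k ∈ v.asIdeal ↔ ‖ι'.symm (w.embedding (k : K))‖ < 1) →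
      ∀ (Φ : AddSubgroup (geomTorsion W (p : ℤ))), IsRationalLine W p Φ →
      ∀ (θsub θquot : FramedGaloisRep ℚ (padicCoeffIntegers (∅ : Set (PadicAlgCl p))) 1),
        IsTeichmullerLiftOn (∅ : Set (PadicAlgCl p)) (Φ.map (geomTorsion W (p : ℤ)).subtype) θsub →
        IsTeichmullerLiftOnQuot (∅ : Set (PadicAlgCl p)) (Φ.map (geomTorsion W (p : ℤ)).subtype)
          (geomTorsion W (p : ℤ)) θquot →
      ∀ (θK : HeckeCharacter K), IsHeckeCharOf ι' (θquot.restrictField K) θK →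
      ∀ (S : Finset (HeightOneSpectrum (𝓞 K))),
        (∀ w : HeightOneSpectrum (𝓞 K), w ∈ S ↔ ¬ θK.IsUnramifiedAt w) →
      ∀ (κ' : ZpExtension K p) (γ' : absoluteGaloisGroup K), ZpExtension.IsTopGeneratorPair κ κ' γ γ' →
      ∀ (Ω δ : ℂ) (Ωp : (unrIntegers p)ˣ) (G : PowerSeries (PowerSeries (PadicComplexInt p)))
        (g : IwasawaAlgebra₂ p), Ω ≠ 0 →
        (δ ^ 2 = (NumberField.discr K : ℂ) ∨ δ ^ 2 = -(NumberField.discr K : ℂ)) →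
        IsKatzMeasure₂ ι' v vbar S κ κ' γ⁻¹ γ'⁻¹ θK⁻¹ Ω δ ((Ωp : unrIntegers p) : ℂ_[p]) G →
        (∀ (J : ℤ_[p] →+* PadicComplexInt p),
          (∀ x : ℤ_[p], ((J x : PadicComplexInt p) : ℂ_[p]) = ((x : ℚ_[p]) : ℂ_[p])) →
          Associated (PowerSeries.map (PowerSeries.map J) g) G) →
        (g.map (PowerSeries.constantCoeff (R := ℤ_[p]))).map (IsLocalRing.residue ℤ_[p]) ≠ 0 →
      ∃ (ΩK' : ℂ) (Ωp' : ℂ_[p]) (Q : PowerSeries 𝓞_ℂ_[p]), ΩK' ≠ 0 ∧ ‖Ωp'‖ = 1 ∧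
        (∀ (φ : HeckeCharacter K) (n : ℕ), 0 < n → (p - 1) ∣ n →
          (∀ w : HeightOneSpectrum (𝓞 K), φ.IsUnramifiedAt w) →
          φ.HasInfinityType (fun _ ↦ (n : ℤ)) (fun _ ↦ -(n : ℤ)) →
          ∀ (hL : LFunction.HasEntireContinuation (heckeLFunction (θK * φ))),
          ∀ r : FramedGaloisRep K (PadicAlgCl p) 1, IsPAdicAvatarOf ι' φ r → FactorsThroughZp κ r →
            IntSeries.HasValueAt Q (avatarValueAt r γ - 1)
              (((ι'.symm (katzInterpolationValue p θK v vbar ∅ φ n ΩK' (hL.continuation 1)) :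
                  PadicAlgCl p) : ℂ_[p]) * Ωp' ^ (2 * n))) ∧
        (‖((PowerSeries.coeff ((g.map (PowerSeries.constantCoeff (R := ℤ_[p]))).map
            (IsLocalRing.residue ℤ_[p])).order.toNat Q : 𝓞_ℂ_[p]) : ℂ_[p])‖ = 1 ∧
          ∀ i < ((g.map (PowerSeries.constantCoeff (R := ℤ_[p]))).map
            (IsLocalRing.residue ℤ_[p])).order.toNat,
            ‖((PowerSeries.coeff i Q : 𝓞_ℂ_[p]) : ℂ_[p])‖ < 1) :=
  fun hF W _ _ p _ ↦ KatzLineFrame.katzLineIntFrame_of_teichmullerPair hF W p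

end Summit.BirchSwinnertonDyer.BirchSwinnertonDyer.Theorems.GoodLatticeBDPValueAnQStubs

end
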